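import Summits.BirchSwinnertonDyer.BirchSwinnertonDyer.Theorems.ByReductionTypeAtTwoSupersingularFlatEvalMapCount
import Summits.BirchSwinnertonDyer.Rank1Residual.X2.GreenbergVatsalUnramifiedAway
import Summits.BirchSwinnertonDyer.Rank1Residual.Additive.LocalTowerKernelCardEqTamagawaCyclotomic
import Summits.BirchSwinnertonDyer.Rank1Residual.P2.EmptyCellsAtTwo
import Summits.BirchSwinnertonDyer.Rank1Residual.X5.RationalTwoTorsionPoints
import Literature.NumberTheory.EllipticCurves.Greenberg1999.CasselsSurjectivityH1Sigma
import Literature.NumberTheory.GaloisRepresentations.PadicAlgebraDegreeOnePlace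
import Literature.NumberTheory.EllipticCurves.SelmerCorankControlRatProofs
import Literature.NumberTheory.EllipticCurves.ComplexMultiplicationBurungaleFlachPrimaryProofs
import Literature.NumberTheory.DiophantineGeometry.LocalReductionFiniteBadPlacesProofs
import Literature.NumberTheory.EllipticCurves.TamagawaSubgroupProofs
import Literature.NumberTheory.EllipticCurves.TamagawaFiniteIndexProofs
import Summits.BirchSwinnertonDyer.BirchSwinnertonDyer.Theorems.ThetaPartnerAtTwoSignedControlAtTwoSignedKummerAtP
import HarnessLib

/-!
# CASSELS' COUNT `#ker g^ε = p^{ord_p ∏ c_ℓ}` for Kobayashi's `Sel^ε(E/ℚ_∞)` from Cassels' theorem BY NAME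
# (Greenberg, LNM 1716 p. 104 «by Cassels' theorem, `ker(g) = ker(r)`»; Prop. 4.13 = tree named fact
# `Greenberg1999.casselsSurjectivity_H1Sigma`) — the equality half of the signed count at `2`

Route `ThetaPartnerAtTwo` (TP2), crux K4 `SignedControlAtTwo` (stmt-BirchSwinnertonDyer-20309), line `eulerchar`
v3: stub `stub_plusCasselsCountTwo` (CASSELS⁺@0 in count form: `Sel_{2^∞}(E/ℚ)` finite ⇒
`#(A⁺_0/Sel_0) = 2^{ord₂ ∏ c_ℓ}`, `A⁺_0 = h_0⁻¹(Sel⁺(E/ℚ_∞))`). This file REDUCES that stub to PRINT BY NAME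
(`Greenberg1999.casselsSurjectivity_H1Sigma ℚ`: Greenberg's Prop. 4.13 / Cassels 1964, Poitou–Tate over `ℚ`,
ANY `p`) + the local stub INJ⁺@2 («`r₂⁺` injective») + kernel — the `±` twin of the ♭ road's part 8
(`…SupersingularFlatCasselsCount`, `bsd-2adic-ss-1` GEN 12; credit for the template). Seat
`prover-bsd-wall-tp2-p3` (lead, LINE mode). HONEST FRAMING: THEOREMS ONLY (no definition, no named fact, no
`sorry`), route-independent; nothing about any curve is asserted beyond the displayed hypotheses; closes no item
by itself; BSD is not proved by any of this.

## What is proved (namespace `…Theorems.SignedEC`)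

* §1 (any number field `K`, prime `p`, `ℤ_p`-extension `κ`, sign `ε`, `E(K)[p] = 0`)
  `layerToInfty_mem_signedSelmerInfty_of_mem_selmerInfty_of_mem_localKerOver` — **a class of `H¹(K, E[p^∞])`
  whose restriction to `K_∞` is classically Selmer and which is Kummer (classical local condition) at the places
  above `p` restricts into `Sel^ε(E/K_∞)`**: `h_0 y = h_m y_m` with `y_m ∈ Sel(E/K_m)`
  (`mem_selmerInfty_iff_exists_layer`), `h_m` injective (`E(K)[p] = 0`), so `y_m = res y`, and a layer-`0`
  Kummer class restricts into the Kummer condition of `E(K_v) ≤ E^ε(K_m·K_v)` (Kobayashi: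
  «`E(ℚ_p) ⊆ E^±(F_{n,p})`», `localLayerPointsOfEmb_zero_le_signedLocalPointsOfEmb`).
* §2 (`K = ℚ`, cyclotomic `κ`, any `p` with `E(ℚ)[p] = 0`) `forall_exists_mem_signedPreimage_localResOver_eq_of_cassels` —
  CASSELS at level `Γ_ℚ` (displayed: the body of `Greenberg1999.casselsSurjectivity_H1Sigma ℚ`) ⇒ the evaluation map
  `Φ : A^ε_0 → ∏_{w ∈ S} 𝒦_{w,0}[p^∞]` is ONTO; `natCard_signedKerG_eq_pow_of_cassels` — hence, with «`r_p^ε`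
  injective», **`#(A^ε_0/Sel_0) = p^{ord_p ∏ c_ℓ}`** (the ♭ road's generic
  `SSFlatEC.natCard_quotient_selmerLayer_zero_eq_prod_of_forall_exists` + Greenberg p. 88 count).
* §3 `natCard_signedKerG_eq_pow_of_casselsSurjectivity` — the same with Cassels BY NAME; and at `p = 2`,
  `GoodSS W 2`, `ε = 1`: `signedCasselsCountTwo_of_localInj_of_casselsSurjectivity` — **the registered stub
  `stub_plusCasselsCountTwo` ⟸ `Greenberg1999.casselsSurjectivity_H1Sigma ℚ` + INJ⁺@2** (`E(ℚ)[2] = 0` at good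
  supersingular `2`, `P2.irr_two_of_goodSS_two`).

References: [GreenbergLNM1716] §3 p. 88; §4 p. 104, Lemma 4.7, Prop. 4.13; [Cassels1964ArithmeticVII]; [BDKim2013] Cor. 3.15.
-/

set_option autoImplicit false
-- the Theorems namespace of this sub repeats the summit name by design (D-0017 nested layout)
set_option linter.dupNamespace false

noncomputable section

open scoped Classical NumberField

open NumberField IsDedekindDomain

universe u

namespace Summit.BirchSwinnertonDyer.BirchSwinnertonDyer.Theorems.SignedEC

open Literature.NumberTheory.EllipticCurves Literature.NumberTheory.GaloisRepresentations
  WeierstrassCurve ZpExtension Literature.NumberTheory.EllipticCurves.Kobayashi2003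
  Literature.NumberTheory.EllipticCurves.IwasawaDual Literature.NumberTheory.EllipticCurves.GreenbergVatsal2000
  Literature.NumberTheory.EllipticCurves.GreenbergSelmer
  Literature.NumberTheory.EllipticCurves.Rank1Residual Summit.BirchSwinnertonDyer.Rank1Residual.X2
  Summit.BirchSwinnertonDyer.BirchSwinnertonDyer.Theorems.FineSelmerLeSignedSelmer

/-! ## §2 Over `ℚ`: the evaluation map of `A^ε_0` is onto, from CASSELS at level `Γ_ℚ` -/

section Rat

variable (W : WeierstrassCurve ℚ) [W.IsElliptic] {p : ℕ} [Fact p.Prime] (κ : ZpExtension ℚ p) (ε : ℤˣ)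

omit [W.IsElliptic] in
/-- `loc_v(h_0 y) = r_v(loc_v y)`: if the layer-`0` local class of `y` at the chosen place above `E` vanishes,
`h_0 y` satisfies the classical local condition over `ℚ_∞` there (`localResOverOfEmb_resOfLe`).
[cite: GreenbergLNM1716, §3 p. 86 (the diagram `s_n`, `h_n`, `g_n`)] -/
theorem layerToInfty_mem_localKerOver_of_localResOver_eq_zero' {E : Type} [Field E] [Algebra ℚ E]
    (y : W.subgroupH1 p (κ.layerSubgroup 0)) (hy : W.localResOver p (κ.layerSubgroup 0) E y = 0) :
    W.layerToInfty κ 0 y ∈ W.localKerOver p κ.kerSubgroup E := by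
  rw [mem_localKerOver_iff]
  have h := W.localResOverOfEmb_resOfLe p (closureEmb (K := ℚ) E) (κ.kerSubgroup_le_layerSubgroup 0) y
  have hy' : W.localResOverOfEmb p (κ.layerSubgroup 0) (closureEmb (K := ℚ) E) y = 0 := hy
  exact h.trans (((congrArg _ hy').trans (map_zero _)))

omit [W.IsElliptic] [Fact p.Prime] in
/-- **Restriction preserves the unramified condition** (`H ≤ H'`, a finite place `v`): if `c ∈ H¹(H', E[p^∞])`
dies on `H' ⊓ I_v` then `res c ∈ H¹(H, E[p^∞])` dies on `H ⊓ I_v` (`resH1Hom_comp`).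
[cite: GreenbergVatsal2000, §2 p. 16] -/
theorem resOfLe_mem_unramifiedKer' {H H' : Subgroup (Field.absoluteGaloisGroup ℚ)} (h : H ≤ H')
    (v : HeightOneSpectrum (𝓞 ℚ)) {c : subgroupH1 H' (W.geomPrimaryTorsion p)}
    (hc : c ∈ unramifiedKer H' (W.geomPrimaryTorsion p) v) :
    Literature.NumberTheory.EllipticCurves.resOfLe (W.geomPrimaryTorsion p) h c ∈
      unramifiedKer H (W.geomPrimaryTorsion p) v := by
  rw [GreenbergVatsal2000.unramifiedKer, AddMonoidHom.mem_ker] at hc ⊢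
  have hincl : inertiaIn H v ≤ inertiaIn H' v := fun x hx ↦
    (mem_inertiaIn_iff H' v x).2 ⟨h ((mem_inertiaIn_iff H v x).1 hx).1, ((mem_inertiaIn_iff H v x).1 hx).2⟩
  have e1 := congrArg (fun f ↦ f c)
    (resH1Hom_comp (Literature.NumberTheory.EllipticCurves.subgroupInclusion h)
      (AddMonoidHom.id (W.geomPrimaryTorsion p))
      (fun _ _ ↦ rfl) (inertiaInToH H v) (AddMonoidHom.id (W.geomPrimaryTorsion p)) (fun _ _ ↦ rfl))
  have e2 := congrArg (fun f ↦ f c)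
    (resH1Hom_comp (inertiaInToH H' v) (AddMonoidHom.id (W.geomPrimaryTorsion p)) (fun _ _ ↦ rfl)
      (Literature.NumberTheory.EllipticCurves.subgroupInclusion hincl) (AddMonoidHom.id (W.geomPrimaryTorsion p))
      (fun _ _ ↦ rfl))
  have mid := congrArg (fun f ↦ f c)
    (resH1Hom_congr
      (φ := (Literature.NumberTheory.EllipticCurves.subgroupInclusion h).comp (inertiaInToH H v))
      (φ' := (inertiaInToH H' v).comp (Literature.NumberTheory.EllipticCurves.subgroupInclusion hincl))
      (ψ := (AddMonoidHom.id (W.geomPrimaryTorsion p)).comp (AddMonoidHom.id (W.geomPrimaryTorsion p)))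
      (ψ' := (AddMonoidHom.id (W.geomPrimaryTorsion p)).comp (AddMonoidHom.id (W.geomPrimaryTorsion p)))
      (by ext; rfl) rfl (fun _ _ ↦ rfl) (fun _ _ ↦ rfl))
  simp only [AddMonoidHom.coe_comp, Function.comp_apply] at e1 e2
  change resH1Hom (inertiaInToH H v) (AddMonoidHom.id (W.geomPrimaryTorsion p)) _
    (Literature.NumberTheory.EllipticCurves.resOfLe (W.geomPrimaryTorsion p) h c) = 0
  rw [Literature.NumberTheory.EllipticCurves.resOfLe, e1, mid, ← e2, hc, map_zero]

omit [W.IsElliptic] [Fact p.Prime] in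
/-- `res : H¹(H', E[p^∞]) → H¹(H, E[p^∞])` maps `unramifiedOutside H' _ p Σ₀` into `unramifiedOutside H _ p Σ₀`
(`res ∘ conj_σ = conj_σ ∘ res`). [cite: GreenbergVatsal2000, §2 p. 16] -/
theorem resOfLe_mem_unramifiedOutside' {H H' : Subgroup (Field.absoluteGaloisGroup ℚ)} [H.Normal] [H'.Normal]
    (h : H ≤ H') (S₀ : Set (HeightOneSpectrum (𝓞 ℚ))) {c : subgroupH1 H' (W.geomPrimaryTorsion p)}
    (hc : c ∈ unramifiedOutside H' (W.geomPrimaryTorsion p) p S₀) :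
    Literature.NumberTheory.EllipticCurves.resOfLe (W.geomPrimaryTorsion p) h c ∈
      unramifiedOutside H (W.geomPrimaryTorsion p) p S₀ := by
  rw [mem_unramifiedOutside_iff] at hc ⊢
  intro v hv hpv σ
  have hcomm := congrArg (fun f ↦ f c) (resOfLe_comp_conjH1_holds (M := W.geomPrimaryTorsion p) h σ)
  simp only [AddMonoidHom.coe_comp, Function.comp_apply] at hcomm
  rw [← hcomm]
  exact resOfLe_mem_unramifiedKer' W h v (hc v hv hpv σ)

/-- **CASSELS at level `Γ_ℚ` ⇒ the evaluation map of `A^ε_0` is onto** (`K = ℚ`, any `p` with `E(ℚ)[p] = 0`,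
CYCLOTOMIC `κ`, `S ⊇` the bad places prime to `p` with `p ∉ S`). Given `(k_w)_{w∈S}`, `k_w ∈ 𝒦_{w,0}[p^∞]`:
CASSELS (the body of `Greenberg1999.casselsSurjectivity_H1Sigma ℚ`, displayed) produces
`y ∈ H¹(ℚ_Σ/ℚ, E[p^∞])` with `loc_w y = k_w` on `S`, `loc_p y = 0`, `loc_∞ y = 0`; its restriction `y₀` to the
`0`-th layer has `loc_w y₀ = k_w` and `h_0 y₀ ∈ Sel(E/ℚ_∞)` (at `w ∈ S`: `r_w k_w = 0`; off `Σ`: unramified ⇒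
Kummer over `ℚ_∞^{cyc}`, `unramKer_le_localKerOver_of_isCyclotomic`; at `∞` and at `p`: `0`), hence
`h_0 y₀ ∈ Sel^ε(E/ℚ_∞)` by §1 (Kummer at `p`). [cite: GreenbergLNM1716, §4 p. 104 («by Cassels' theorem,
ker(g) = ker(r)») and p. 122] [cite: Kobayashi2003, Def. 1.1] -/
theorem forall_exists_mem_signedPreimage_localResOver_eq_of_cassels (hκ : κ.IsCyclotomic)
    (hinjh : ∀ m, Function.Injective (W.layerToInfty κ m))
    (S : Finset (HeightOneSpectrum (𝓞 ℚ))) (hSp : ∀ w ∈ S, (p : 𝓞 ℚ) ∉ w.asIdeal)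
    (hS : ∀ w : HeightOneSpectrum (𝓞 ℚ), w ∉ S → (p : 𝓞 ℚ) ∉ w.asIdeal → W.HasGoodReductionAt w)
    (hCas : ∀ (x : ∀ w : HeightOneSpectrum (𝓞 ℚ),
        discreteH1 (localSubgroup (⊤ : Subgroup (Field.absoluteGaloisGroup ℚ)) (w.adicCompletion ℚ))
          (localPoints W (w.adicCompletion ℚ)))
      (xi : ∀ w : InfinitePlace ℚ,
        discreteH1 (localSubgroup (⊤ : Subgroup (Field.absoluteGaloisGroup ℚ)) w.Completion)
          (localPoints W w.Completion)),
      (∀ w, ∃ k : ℕ, p ^ k • x w = 0) → (∀ w, ∃ k : ℕ, p ^ k • xi w = 0) →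
      ∃ y : W.subgroupH1 p (⊤ : Subgroup (Field.absoluteGaloisGroup ℚ)),
        y ∈ unramifiedOutside (⊤ : Subgroup (Field.absoluteGaloisGroup ℚ)) (W.geomPrimaryTorsion p) p
          (↑S : Set (HeightOneSpectrum (𝓞 ℚ))) ∧
        (∀ w, (w ∈ (↑S : Set (HeightOneSpectrum (𝓞 ℚ))) ∨ ((p : ℕ) : 𝓞 ℚ) ∈ w.asIdeal) →
          W.localResOver p ⊤ (w.adicCompletion ℚ) y = x w) ∧
        (∀ w, W.localResOver p ⊤ w.Completion y = xi w)) :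
    ∀ k : (Π w : ↥S, ↥(W.localTowerKerPrimary κ (w.1.adicCompletion ℚ) 0)),
      ∃ y ∈ (signedSelmerInfty W κ ε).comap (W.layerToInfty κ 0),
        ∀ w : ↥S, W.localResOver p (κ.layerSubgroup 0) (w.1.adicCompletion ℚ) y = (k w : _) := by
  intro k
  have hle : ∀ w : HeightOneSpectrum (𝓞 ℚ),
      localSubgroup (⊤ : Subgroup (Field.absoluteGaloisGroup ℚ)) (w.adicCompletion ℚ) ≤
        localSubgroup (κ.layerSubgroup 0) (w.adicCompletion ℚ) := fun w τ _ ↦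
    (mem_localSubgroup_iff _ _ τ).mpr (by rw [ZpExtension.layerSubgroup_zero]; trivial)
  have hge : ∀ w : HeightOneSpectrum (𝓞 ℚ),
      localSubgroup (κ.layerSubgroup 0) (w.adicCompletion ℚ) ≤
        localSubgroup (⊤ : Subgroup (Field.absoluteGaloisGroup ℚ)) (w.adicCompletion ℚ) := fun w ↦
    Subgroup.comap_mono le_top
  let x : ∀ w : HeightOneSpectrum (𝓞 ℚ),
      discreteH1 (localSubgroup (⊤ : Subgroup (Field.absoluteGaloisGroup ℚ)) (w.adicCompletion ℚ))
        (localPoints W (w.adicCompletion ℚ)) := fun w ↦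
    if h : w ∈ S then
      Literature.NumberTheory.EllipticCurves.resOfLe (localPoints W (w.adicCompletion ℚ)) (hle w)
        ((k ⟨w, h⟩ : ↥(W.localTowerKerPrimary κ (w.adicCompletion ℚ) 0)) : _)
    else 0
  have hx_tor : ∀ w, ∃ n : ℕ, p ^ n • x w = 0 := fun w ↦ by
    by_cases h : w ∈ S
    · obtain ⟨n, hn⟩ := (k ⟨w, h⟩).2.2
      refine ⟨n, ?_⟩
      simp only [x, dif_pos h]
      rw [← map_nsmul, hn, map_zero]
    · exact ⟨0, by simp only [x, dif_neg h, smul_zero]⟩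
  obtain ⟨y, hyH, hyfin, hyinf⟩ := hCas x (fun _ ↦ 0) hx_tor (fun _ ↦ ⟨0, smul_zero _⟩)
  let y₀ : W.subgroupH1 p (κ.layerSubgroup 0) := W.resOfLe p (le_top : κ.layerSubgroup 0 ≤ ⊤) y
  have hloc0 : ∀ w : HeightOneSpectrum (𝓞 ℚ), W.localResOver p (κ.layerSubgroup 0) (w.adicCompletion ℚ) y₀ =
      Literature.NumberTheory.EllipticCurves.resOfLe (localPoints W (w.adicCompletion ℚ)) (hge w)
        (W.localResOver p ⊤ (w.adicCompletion ℚ) y) := fun w ↦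
    W.localResOverOfEmb_resOfLe p (closureEmb (K := ℚ) (w.adicCompletion ℚ))
      (le_top : κ.layerSubgroup 0 ≤ ⊤) y
  have hloc0inf : ∀ w : InfinitePlace ℚ, W.localResOver p (κ.layerSubgroup 0) w.Completion y₀ = 0 :=
    fun w ↦ by
    have h := W.localResOverOfEmb_resOfLe p (closureEmb (K := ℚ) w.Completion)
      (le_top : κ.layerSubgroup 0 ≤ ⊤) y
    have h0 : W.localResOverOfEmb p ⊤ (closureEmb (K := ℚ) w.Completion) y = 0 := hyinf w
    exact h.trans ((congrArg _ h0).trans (map_zero _))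
  have hkS : ∀ w : ↥S, W.localResOver p (κ.layerSubgroup 0) (w.1.adicCompletion ℚ) y₀ = (k w : _) := by
    intro w
    rw [hloc0 w.1, hyfin w.1 (Or.inl (Finset.mem_coe.mpr w.2))]
    simp only [x, dif_pos w.2]
    have e : (Literature.NumberTheory.EllipticCurves.resOfLe (localPoints W (w.1.adicCompletion ℚ)) (hge w.1)).comp
        (Literature.NumberTheory.EllipticCurves.resOfLe (localPoints W (w.1.adicCompletion ℚ)) (hle w.1)) =
        AddMonoidHom.id _ := by
      rw [resOfLe_comp_holds (M := localPoints W (w.1.adicCompletion ℚ)) (hge w.1) (hle w.1)]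
      exact resOfLe_refl_holds (M := localPoints W (w.1.adicCompletion ℚ)) _
    exact DFunLike.congr_fun e _
  have hkp : ∀ w : HeightOneSpectrum (𝓞 ℚ), (p : 𝓞 ℚ) ∈ w.asIdeal →
      W.localResOver p (κ.layerSubgroup 0) (w.adicCompletion ℚ) y₀ = 0 := fun w hw ↦ by
    have hwS : w ∉ S := fun h ↦ hSp w h hw
    rw [hloc0 w, hyfin w (Or.inr hw)]
    simp only [x, dif_neg hwS, map_zero]
  refine ⟨y₀, ?_, hkS⟩
  rw [AddSubgroup.mem_comap]
  have hinv : ∀ σ : Field.absoluteGaloisGroup ℚ,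
      W.conjH1 p κ.kerSubgroup σ (W.layerToInfty κ 0 y₀) = W.layerToInfty κ 0 y₀ := fun σ ↦ by
    have hmem := W.range_layerToInfty_le_layerInvariants_holds κ 0 ⟨y₀, rfl⟩
    rw [W.mem_layerInvariants_iff κ 0] at hmem
    exact hmem σ (by rw [ZpExtension.layerSubgroup_zero]; trivial)
  have hy0H : y₀ ∈ unramifiedOutside (κ.layerSubgroup 0) (W.geomPrimaryTorsion p) p
      (↑S : Set (HeightOneSpectrum (𝓞 ℚ))) :=
    resOfLe_mem_unramifiedOutside' W (le_top : κ.layerSubgroup 0 ≤ ⊤) _ hyH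
  have hhy0H : W.layerToInfty κ 0 y₀ ∈ unramifiedOutside κ.kerSubgroup (W.geomPrimaryTorsion p) p
      (↑S : Set (HeightOneSpectrum (𝓞 ℚ))) :=
    resOfLe_mem_unramifiedOutside' W (κ.kerSubgroup_le_layerSubgroup 0) _ hy0H
  have hsel : W.layerToInfty κ 0 y₀ ∈ W.selmerInfty κ := by
    refine (W.mem_selmerGroupOver_iff p κ.kerSubgroup _).mpr ⟨fun w σ ↦ ?_, fun w σ ↦ ?_⟩
    · rw [hinv σ]
      by_cases hpw : (p : 𝓞 ℚ) ∈ w.asIdeal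
      · exact layerToInfty_mem_localKerOver_of_localResOver_eq_zero' W κ y₀ (hkp w hpw)
      · by_cases hwS : w ∈ S
        · rw [mem_localKerOver_iff]
          have h := W.localResOverOfEmb_resOfLe p (closureEmb (K := ℚ) (w.adicCompletion ℚ))
            (κ.kerSubgroup_le_layerSubgroup 0) y₀
          have h1 : W.localResOver p (κ.layerSubgroup 0) (w.adicCompletion ℚ) y₀ =
              ((k ⟨w, hwS⟩ : ↥(W.localTowerKerPrimary κ (w.adicCompletion ℚ) 0)) :
                discreteH1 (localSubgroup (κ.layerSubgroup 0) (w.adicCompletion ℚ))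
                  (localPoints W (w.adicCompletion ℚ))) := hkS ⟨w, hwS⟩
          have h2 := ((W.mem_localTowerKerPrimary_iff κ (w.adicCompletion ℚ) 0 _).mp (k ⟨w, hwS⟩).2).1
          rw [W.mem_localTowerKer_iff] at h2
          exact h.trans ((congrArg _ h1).trans h2)
        · have h1 : W.conjH1 p κ.kerSubgroup 1 (W.layerToInfty κ 0 y₀) ∈
              W.localKerOver p κ.kerSubgroup (w.adicCompletion ℚ) :=
            GreenbergVatsalUnramifiedAway.unramKer_le_localKerOver_of_isCyclotomic (κ := κ) (v := w)
              (W := W) (p := p) hκ (hS w hwS hpw) hpw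
              ((mem_unramifiedOutside_iff _).mp hhy0H w (fun h ↦ hwS (Finset.mem_coe.mp h)) hpw 1)
          rwa [W.conjH1_one_holds p κ.kerSubgroup, AddMonoidHom.id_apply] at h1
    · rw [hinv σ]
      exact layerToInfty_mem_localKerOver_of_localResOver_eq_zero' W κ y₀ (hloc0inf w)
  exact layerToInfty_mem_signedSelmerInfty_of_mem_selmerInfty_of_mem_localKerOver W κ ε hinjh hsel
    fun w hw ↦ (W.mem_localKerOver_iff p (κ.layerSubgroup 0) (w.adicCompletion ℚ) y₀).mpr
      (hkp w (by exact_mod_cast hw))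

/-- **CASSELS' COUNT from CASSELS for `Sel^ε`.** `W/ℚ` elliptic, globally minimal, GOOD at `p`, `E(ℚ)[p] = 0`;
`κ` cyclotomic; «`r_p^ε` injective» (every class of `A^ε_0` is classically Selmer at the place above `p`);
CASSELS at level `Γ_ℚ` (displayed). Then **`#(A^ε_0/Sel_0) = p^{ord_p ∏_ℓ c_ℓ}`** — Greenberg's «by Cassels'
theorem, `ker(g) = ker(r)`» (p. 104) with `|ker(r_ℓ)| = c_ℓ^{(p)}` (p. 88; tree), `ker(r_p) = 0`, nothing at `∞`.
[cite: GreenbergLNM1716, §4 p. 104 and Lemma 4.7; §3 Lemma 3.3 and p. 88] [cite: BDKim2013, proof of Cor. 3.15] -/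
theorem natCard_signedKerG_eq_pow_of_cassels [W.IsGloballyMinimal] (hκ : κ.IsCyclotomic)
    (hinjh : ∀ m, Function.Injective (W.layerToInfty κ m))
    {v : HeightOneSpectrum (𝓞 ℚ)} (hv : (p : 𝓞 ℚ) ∈ v.asIdeal) (hgood : W.HasGoodReductionAt v)
    (hinj : ∀ v' : HeightOneSpectrum (𝓞 ℚ), (p : 𝓞 ℚ) ∈ v'.asIdeal →
      ∀ y ∈ (signedSelmerInfty W κ ε).comap (W.layerToInfty κ 0),
        W.localResOver p (κ.layerSubgroup 0) (v'.adicCompletion ℚ) y = 0)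
    (hCas : ∀ (S₀ : Set (HeightOneSpectrum (𝓞 ℚ))), S₀.Finite →
      (∀ w : HeightOneSpectrum (𝓞 ℚ), w ∉ S₀ → ((p : ℕ) : 𝓞 ℚ) ∉ w.asIdeal → W.HasGoodReductionAt w) →
      ∀ (x : ∀ w : HeightOneSpectrum (𝓞 ℚ),
        discreteH1 (localSubgroup (⊤ : Subgroup (Field.absoluteGaloisGroup ℚ)) (w.adicCompletion ℚ))
          (localPoints W (w.adicCompletion ℚ)))
      (xi : ∀ w : InfinitePlace ℚ,
        discreteH1 (localSubgroup (⊤ : Subgroup (Field.absoluteGaloisGroup ℚ)) w.Completion)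
          (localPoints W w.Completion)),
      (∀ w, ∃ k : ℕ, p ^ k • x w = 0) → (∀ w, ∃ k : ℕ, p ^ k • xi w = 0) →
      ∃ y : W.subgroupH1 p (⊤ : Subgroup (Field.absoluteGaloisGroup ℚ)),
        y ∈ unramifiedOutside (⊤ : Subgroup (Field.absoluteGaloisGroup ℚ)) (W.geomPrimaryTorsion p) p S₀ ∧
        (∀ w, (w ∈ S₀ ∨ ((p : ℕ) : 𝓞 ℚ) ∈ w.asIdeal) → W.localResOver p ⊤ (w.adicCompletion ℚ) y = x w) ∧
        (∀ w, W.localResOver p ⊤ w.Completion y = xi w)) :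
    Nat.card (↥((signedSelmerInfty W κ ε).comap (W.layerToInfty κ 0)) ⧸
      (W.selmerLayer κ 0).addSubgroupOf ((signedSelmerInfty W κ ε).comap (W.layerToInfty κ 0))) =
      p ^ padicValNat p W.tamagawaProduct := by
  have hbad : (W.badPlaces (𝓞 ℚ)).Finite := W.finite_badPlaces_holds (𝓞 ℚ)
  let S : Finset (HeightOneSpectrum (𝓞 ℚ)) := hbad.toFinset
  have hSmem : ∀ w : HeightOneSpectrum (𝓞 ℚ), w ∈ S ↔ ¬ W.HasGoodReductionAt w := fun w ↦ by
    simp only [S, Set.Finite.mem_toFinset, WeierstrassCurve.badPlaces, Set.mem_setOf_eq]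
  have hv' : ∀ w : HeightOneSpectrum (𝓞 ℚ), (p : 𝓞 ℚ) ∈ w.asIdeal → w = v := fun w hw ↦
    Literature.NumberTheory.GaloisRepresentations.LocalField.heightOneSpectrum_rat_eq_of_natCast_mem p w v
      hw hv
  have hSp : ∀ w ∈ S, (p : 𝓞 ℚ) ∉ w.asIdeal := fun w hw hpw ↦ by
    rw [hv' w hpw] at hw
    exact (hSmem v).mp hw hgood
  have hS : ∀ w : HeightOneSpectrum (𝓞 ℚ), w ∉ S → (p : 𝓞 ℚ) ∉ w.asIdeal → W.HasGoodReductionAt w := by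
    intro w hw _
    by_contra hng
    exact hw ((hSmem w).mpr hng)
  have hcount := SSFlatEC.natCard_quotient_selmerLayer_zero_eq_prod_of_forall_exists W κ _
    (AddSubgroup.comap_mono (signedSelmerInfty_le_selmerInfty W κ ε)) hinj S hS
    (forall_exists_mem_signedPreimage_localResOver_eq_of_cassels W κ ε hκ hinjh S hSp hS
      (hCas (↑S) (Finset.finite_toSet S) (fun w hw hpw ↦ hS w (fun h ↦ hw (Finset.mem_coe.mpr h)) hpw)))
  rw [hcount]
  have h2 : ∏ w ∈ S, Nat.card (W.localTowerKerPrimary κ (w.adicCompletion ℚ) 0) =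
      ∏ w ∈ S, p ^ padicValNat p
        ((W.baseChange (w.adicCompletion ℚ)).localTamagawaNumber (w.adicCompletionIntegers ℚ)) :=
    Finset.prod_congr rfl fun w hw ↦
      Summit.BirchSwinnertonDyer.Rank1Residual.Additive.natCard_localTowerKerPrimary_zero_eq_pow_of_isCyclotomic
        W hκ (hSp w hw)
  have hsupp : (Function.mulSupport fun w : HeightOneSpectrum (𝓞 ℚ) ↦
      (W.baseChange (w.adicCompletion ℚ)).localTamagawaNumber (w.adicCompletionIntegers ℚ)) ⊆ ↑S := by
    intro w hw
    rw [Finset.mem_coe, hSmem]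
    intro hgw
    exact hw (W.localTamagawaNumber_eq_one_of_hasGoodReductionAt_holds w hgw)
  have h4 : ∏ w ∈ S, (W.baseChange (w.adicCompletion ℚ)).localTamagawaNumber (w.adicCompletionIntegers ℚ) =
      W.tamagawaProduct := by
    rw [WeierstrassCurve.tamagawaProduct, finprod_eq_prod_of_mulSupport_subset _ hsupp]
  have hne : ∀ w ∈ S, (W.baseChange (w.adicCompletion ℚ)).localTamagawaNumber (w.adicCompletionIntegers ℚ) ≠ 0 := by
    intro w _ h0
    have := W.tamagawaProduct_pos'
    rw [← h4, Finset.prod_eq_zero ‹w ∈ S› h0] at this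
    exact lt_irrefl 0 this
  have hprod : ∀ T : Finset (HeightOneSpectrum (𝓞 ℚ)), T ⊆ S →
      padicValNat p (∏ w ∈ T, (W.baseChange (w.adicCompletion ℚ)).localTamagawaNumber (w.adicCompletionIntegers ℚ)) =
        ∑ w ∈ T, padicValNat p ((W.baseChange (w.adicCompletion ℚ)).localTamagawaNumber (w.adicCompletionIntegers ℚ)) := by
    intro T hT
    induction T using Finset.induction_on with
    | empty => simp
    | insert a T ha ih =>
      rw [Finset.prod_insert ha, Finset.sum_insert ha,
        padicValNat.mul (hne a (hT (Finset.mem_insert_self a T)))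
          (Finset.prod_ne_zero_iff.mpr fun i hi ↦ hne i (hT (Finset.mem_insert_of_mem hi))),
        ih (fun i hi ↦ hT (Finset.mem_insert_of_mem hi))]
  rw [h2, Finset.prod_pow_eq_pow_sum, ← h4, hprod S le_rfl]

/-! ## §3 CASSELS by name; the registered stub `stub_plusCasselsCountTwo` from PRINT + INJ⁺@2 -/

/-- **CASSELS' COUNT `#(A^ε_0/Sel_0) = p^{ord_p ∏_ℓ c_ℓ}` with Cassels' theorem supplied BY NAME** from the
Literature fact `Greenberg1999.casselsSurjectivity_H1Sigma ℚ` (LNM 1716 Prop. 4.13 / p. 122; any `p`) under its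
printed hypotheses `Sel_{p^∞}(E/ℚ)` finite and `E(ℚ)[p^∞] = 0` — for `W/ℚ` globally minimal with GOOD reduction at
`p`, `E(ℚ)[p] = 0`, `κ` cyclotomic, either sign, and «`r_p^ε` injective».
[cite: GreenbergLNM1716, §4 p. 104, Prop. 4.13 and p. 122; §3 p. 88] [cite: BDKim2013, proof of Cor. 3.15] -/
theorem natCard_signedKerG_eq_pow_of_casselsSurjectivity [W.IsGloballyMinimal]
    (hC : Greenberg1999.casselsSurjectivity_H1Sigma ℚ) (hκ : κ.IsCyclotomic)
    (hinjh : ∀ m, Function.Injective (W.layerToInfty κ m))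
    (hE : Nat.card (MulAction.fixedPoints (Field.absoluteGaloisGroup ℚ) (W.geomPrimaryTorsion p)) = 1)
    {v : HeightOneSpectrum (𝓞 ℚ)} (hv : (p : 𝓞 ℚ) ∈ v.asIdeal) (hgood : W.HasGoodReductionAt v)
    (hinj : ∀ v' : HeightOneSpectrum (𝓞 ℚ), (p : 𝓞 ℚ) ∈ v'.asIdeal →
      ∀ y ∈ (signedSelmerInfty W κ ε).comap (W.layerToInfty κ 0),
        W.localResOver p (κ.layerSubgroup 0) (v'.adicCompletion ℚ) y = 0)
    (hSel : Finite (W.selmerGroupPInfty p)) :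
    Nat.card (↥((signedSelmerInfty W κ ε).comap (W.layerToInfty κ 0)) ⧸
      (W.selmerLayer κ 0).addSubgroupOf ((signedSelmerInfty W κ ε).comap (W.layerToInfty κ 0))) =
      p ^ padicValNat p W.tamagawaProduct :=
  natCard_signedKerG_eq_pow_of_cassels W κ ε hκ hinjh hv hgood hinj
    (fun S₀ hS₀ hgood' x xi hx hxi ↦ hC W p hSel hE S₀ hS₀ hgood' x xi hx hxi)

/-- **The registered stub `stub_plusCasselsCountTwo` of line `eulerchar` v3 (crux K4 `SignedControlAtTwo`,
stmt-BirchSwinnertonDyer-20309) ⟸ Cassels' theorem BY NAME + INJ⁺@2.** For `W/ℚ` elliptic, globally minimal,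
good supersingular at `2` (`GoodSS W 2`; so `E(ℚ)[2] = 0`, `P2.irr_two_of_goodSS_two`), the cyclotomic
`ℤ₂`-extension `κ`, given «`r₂⁺` injective» on the classes of `A⁺_0` and the Literature fact
`Greenberg1999.casselsSurjectivity_H1Sigma ℚ`: `Sel_{2^∞}(E/ℚ)` finite ⇒ **`#(A⁺_0/Sel_0) = 2^{ord₂ ∏_ℓ c_ℓ}`**.
So CASSELS⁺@0 costs nothing at `2` beyond PRINT (Prop. 4.13 holds for every `p`) and the `±` local input.
[cite: GreenbergLNM1716, §4 p. 104, Prop. 4.13 (p. 122)] [cite: BDKim2013, proof of Cor. 3.15 (pp. 199–200)] -/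
theorem signedCasselsCountTwo_of_localInj_of_casselsSurjectivity [W.IsGloballyMinimal]
    (hC : Greenberg1999.casselsSurjectivity_H1Sigma ℚ) (hss : GoodSS W 2) {κ₂ : ZpExtension ℚ 2}
    (hκ : κ₂.IsCyclotomic)
    (hinj : ∀ v : HeightOneSpectrum (𝓞 ℚ), (2 : 𝓞 ℚ) ∈ v.asIdeal →
      ∀ y ∈ (signedSelmerInfty W κ₂ 1).comap (W.layerToInfty κ₂ 0),
        W.localResOver 2 (κ₂.layerSubgroup 0) (v.adicCompletion ℚ) y = 0)
    (hSel : Finite (W.selmerGroupPInfty 2)) :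
    Nat.card (↥((signedSelmerInfty W κ₂ 1).comap (W.layerToInfty κ₂ 0)) ⧸
      (W.selmerLayer κ₂ 0).addSubgroupOf ((signedSelmerInfty W κ₂ 1).comap (W.layerToInfty κ₂ 0))) =
      2 ^ padicValNat 2 W.tamagawaProduct := by
  -- `E(ℚ)[2] = 0` at good supersingular `2` (the two `DecidableEq ℚ` instances bridged by `convert`)
  have hirr := (Summit.BirchSwinnertonDyer.Rank1Residual.X5.O1.irr_two_iff_forall_two_nsmul W).mp
    (Summit.BirchSwinnertonDyer.Rank1Residual.P2.irr_two_of_goodSS_two W hss)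
  have hE : Nat.card (MulAction.fixedPoints (Field.absoluteGaloisGroup ℚ) (W.geomPrimaryTorsion 2)) = 1 := by
    refine W.natCard_fixedPoints_absoluteGaloisGroup_geomPrimaryTorsion_eq_one (p := 2) fun P hP ↦ ?_
    apply hirr P
    convert hP
  have hinjh : ∀ m, Function.Injective (W.layerToInfty κ₂ m) := fun m ↦ by
    refine Summit.BirchSwinnertonDyer.Rank1Residual.Additive.layerToInfty_injective_of_no_pTorsion W κ₂
      (fun P hP ↦ ?_) m
    apply hirr P
    convert hP
  -- the place `v ∋ 2`
  obtain ⟨v, hv⟩ : ∃ v : HeightOneSpectrum (𝓞 ℚ), ((2 : ℕ) : 𝓞 ℚ) ∈ v.asIdeal :=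
    Literature.NumberTheory.EllipticCurves.exists_heightOneSpectrum_natCast_mem (K := ℚ) Nat.prime_two
  have hgood : W.HasGoodReductionAt v := W.hasGoodReductionAt_of_hasGoodReductionAtPrime v hv hss.1
  exact natCard_signedKerG_eq_pow_of_casselsSurjectivity W κ₂ 1 hC hκ hinjh hE hv hgood hinj hSel

end Rat

end Summit.BirchSwinnertonDyer.BirchSwinnertonDyer.Theorems.SignedEC

end
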